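import Summits.BirchSwinnertonDyer.BirchSwinnertonDyer.Theorems.ResidualThetaTransportAtTwoThetaLayerLambdaCongruenceAtTwoCuspSpanCharacterOdd
import Summits.BirchSwinnertonDyer.BirchSwinnertonDyer.Theorems.ResidualThetaTransportAtTwoThetaLayerLambdaCongruenceAtTwoCuspSpanPotential
import Mathlib.NumberTheory.LSeries.PrimesInAP
import HarnessLib

/-!
# Route `ResidualThetaTransportAtTwo`, cruxes Kan⁺ (stmt-BirchSwinnertonDyer-20688) / node 27436 / 21437: the rows `|b| = 2` and `|b| = 4^i`
# of `Γ₀(N)` are killed for free (every odd level `N`)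

Cell `bsd-wall`, width seat `bsd-wall-rtt-p3-w4` g2 (2026-08-28), lane «3-fold B₁-products at prime-power and composite level».
THEOREMS ONLY; `--supports stmt-BirchSwinnertonDyer-20688`; BSD is not proved by this.

Context: at an odd COMPOSITE level the node (G′)_N is equivalent to (G‴)_N «every additive `χ : Γ₀(N) → 𝔽₂` killing the elements of
trace `0, ±1, ±2`, the elements with `|d| = 4^k` (`k ≥ 1`) and the row `B₁ = {b = −1}` vanishes» (`…CuspSpanCharacterOdd`); numerically
(rtt-p4-w2 g6) `B₁` spans only at `p^e, pq, pq²`, and further rows `B_m = {|b| = m}`, `m ≤ M(N)`, are needed at other levels. HERE: the rows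
`m = 2` and `m = 4^i` cost nothing.
* §1 `chi_eq_zero_of_b_neg_of_prime_dvd` — the mechanism: `γ = (a, −m; Nc, d)`, a prime `P ≡ a (mod mN)` with `P ∣ m·4^k − 1` (`k ≥ 1`):
  then `γ L_t = (P, −m; ∗, d)` and for `σ = (x, u; Ny, 4^k)` (`u = (m4^k − 1)/P`, killed: `|d(σ)| = 4^k`) the product `γ L_t σ` has
  upper-right entry `P u − m 4^k = −1`, so it is killed, hence so is `γ`.
* §2 `chi_eq_zero_of_natAbs_b_eq_two_odd` — **`|b| = 2`**: Dirichlet prime `P ≡ a (mod N)`, `P ≡ 7 (mod 8)`; `2·4^k = 2^{(P−1)/2} ≡ +1`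
  (Euler's criterion, `k = (P−3)/4`).
* §3 `chi_eq_zero_of_natAbs_b_eq_four_pow_odd` — **`|b| = 4^i`**: any prime `P ≡ a (mod 4^i N)`; `4^i·4^k = 4^{(P−1)(i+1)} ≡ 1` (Fermat).
(`m = 3` would need `3 ∈ ±⟨4⟩ (mod P)` for a prime in a prescribed class — an Artin-type condition; not available by congruences.)

References: [Rademacher1929] §1; [Pollack2003] Conj. 6.3; Dirichlet / Mathlib `Nat.forall_exists_prime_gt_and_zmodEq`; [IrelandRosen1990] Ch. 5.
-/

set_option autoImplicit false
set_option linter.dupNamespace false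

open scoped MatrixGroups

open CongruenceSubgroup

namespace Summit.BirchSwinnertonDyer.BirchSwinnertonDyer.Theorems.SignedMuAtTwo

variable {N : ℕ} {χ : Gamma0 N → ZMod 2}

/-! ## §1. The mechanism -/

/-- **Row killing from a prime `P ≡ a (mod mN)` dividing `m·4^k − 1`.** Let `χ` be additive, kill the small-trace elements, the
`|d| = 4^k` elements and the row `b = −1`; let `γ = (a, −m; Nc, d) ∈ Γ₀(N)` (`N` odd), `P` with `mN ∣ a − P`, `k ≥ 1`, `P ∣ m 4^k − 1`.
Then `χ γ = 0`. [cite: Rademacher1929, §1] -/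
theorem chi_eq_zero_of_b_neg_of_prime_dvd [NeZero N] (hN : Odd N)
    (hadd : ∀ γ δ : Gamma0 N, χ (γ * δ) = χ γ + χ δ)
    (hsmall : ∀ γ : Gamma0 N, ((γ : SL(2, ℤ)) 0 0 + (γ : SL(2, ℤ)) 1 1).natAbs ≤ 2 → χ γ = 0)
    (hkill : ∀ γ : Gamma0 N, (∃ k : ℕ, 1 ≤ k ∧ ((γ : SL(2, ℤ)) 1 1).natAbs = 4 ^ k) → χ γ = 0)
    (hB1 : ∀ β : Gamma0 N, (β : SL(2, ℤ)) 0 1 = -1 → χ β = 0)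
    {γ : Gamma0 N} (m : ℕ) (hb : (γ : SL(2, ℤ)) 0 1 = -(m : ℤ))
    (P : ℤ) (hPa : ((m * N : ℕ) : ℤ) ∣ (γ : SL(2, ℤ)) 0 0 - P) (k : ℕ) (hk : 1 ≤ k)
    (hPdvd : P ∣ (m : ℤ) * 4 ^ k - 1) : χ γ = 0 := by
  -- move `a` to `P` by a right `L_t`
  obtain ⟨t, ht⟩ := hPa
  obtain ⟨L, hL00, hL01, hL10, hL11⟩ :=
    ThetaLayerLambdaCongruenceAtTwo.exists_gamma0_entries (N := N) 1 0 ((N : ℤ) * t) 1 (by ring) (dvd_mul_right _ _)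
  have hL : χ L = 0 := hsmall L (by rw [hL00, hL11]; decide)
  have g00 : ((γ * L : Gamma0 N) : SL(2, ℤ)) 0 0 = P := by
    rw [gamma0_mul_apply_zero_zero', hL00, hL10, hb]; push_cast at ht; linear_combination ht
  have g01 : ((γ * L : Gamma0 N) : SL(2, ℤ)) 0 1 = -(m : ℤ) := by
    rw [gamma0_mul_apply_zero_one, hL01, hL11, hb]; ring
  -- the `4^k`-element `σ = (x, u; Ny, 4^k)`, `P u = m 4^k − 1`
  obtain ⟨u, hu⟩ := hPdvd
  have huodd : Odd u := by
    have h1 : Odd ((m : ℤ) * 4 ^ k - 1) := by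
      have : Even ((m : ℤ) * 4 ^ k) := by
        obtain ⟨k', rfl⟩ : ∃ k', k = k' + 1 := ⟨k - 1, by omega⟩
        exact ⟨(m : ℤ) * 4 ^ k' * 2, by ring⟩
      exact this.sub_odd odd_one
    rw [hu] at h1
    exact (Int.odd_mul.mp h1).2
  have hNodd : Odd (N : ℤ) := by exact_mod_cast hN
  have hcop : IsCoprime ((4 : ℤ) ^ k) (u * N) := by
    have h2 : IsCoprime (2 : ℤ) (u * N) := by
      obtain ⟨w, hw⟩ := huodd.mul hNodd
      exact ⟨-w, 1, by rw [hw]; ring⟩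
    rw [show ((4 : ℤ)) ^ k = 2 ^ (2 * k) by rw [pow_mul]; norm_num]
    exact h2.pow_left
  obtain ⟨x, y, hxy⟩ := hcop
  obtain ⟨σ, s00, s01, s10, s11⟩ :=
    ThetaLayerLambdaCongruenceAtTwo.exists_gamma0_entries (N := N) x u ((N : ℤ) * (-y)) (4 ^ k) (by linear_combination hxy)
      (dvd_mul_right _ _)
  have hσ : χ σ = 0 := hkill σ ⟨k, hk, by rw [s11, Int.natAbs_pow]; rfl⟩
  -- the product lands in `B₁`
  have hprod : ((γ * L * σ : Gamma0 N) : SL(2, ℤ)) 0 1 = -1 := by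
    rw [gamma0_mul_apply_zero_one, g00, g01, s01, s11]; linear_combination -hu
  have h0 := hB1 _ hprod
  rw [hadd, hadd, hL, hσ, add_zero, add_zero] at h0
  exact h0

/-- Entries of the inverse in `Γ₀(N)`. [folklore] -/
theorem coe_inv_apply_zero_one (γ : Gamma0 N) : ((γ⁻¹ : Gamma0 N) : SL(2, ℤ)) 0 1 = -((γ : SL(2, ℤ)) 0 1) := by
  rw [InvMemClass.coe_inv, Matrix.SpecialLinearGroup.SL2_inv_expl]; rfl

/-- Entries of the inverse in `Γ₀(N)`. [folklore] -/
theorem coe_inv_apply_zero_zero (γ : Gamma0 N) : ((γ⁻¹ : Gamma0 N) : SL(2, ℤ)) 0 0 = (γ : SL(2, ℤ)) 1 1 := by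
  rw [InvMemClass.coe_inv, Matrix.SpecialLinearGroup.SL2_inv_expl]; rfl

/-- The upper-left entry is prime to `b N`: from `a d − b c = 1`, `N ∣ c`. [folklore] -/
theorem isCoprime_apply_zero_zero_mul (γ : Gamma0 N) : IsCoprime ((γ : SL(2, ℤ)) 0 0) ((γ : SL(2, ℤ)) 0 1 * N) := by
  have hdet := Matrix.SpecialLinearGroup.det_coe (γ : SL(2, ℤ))
  rw [Matrix.det_fin_two] at hdet
  obtain ⟨c, hc⟩ : (N : ℤ) ∣ (γ : SL(2, ℤ)) 1 0 := by
    have h := γ.2; rw [Gamma0_mem] at h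
    exact (ZMod.intCast_zmod_eq_zero_iff_dvd _ N).mp h
  exact ⟨(γ : SL(2, ℤ)) 1 1, -c, by rw [hc] at hdet; linear_combination hdet⟩

/-- A prime in a prescribed class: integer form of Dirichlet's theorem. [folklore] -/
theorem exists_prime_sub_dvd (M : ℕ) (hM : M ≠ 0) (a : ℤ) (ha : IsCoprime a M) (n₀ : ℕ) :
    ∃ P : ℕ, n₀ < P ∧ P.Prime ∧ (M : ℤ) ∣ a - P := by
  obtain ⟨P, hP, hPp, hmod⟩ := Nat.forall_exists_prime_gt_and_zmodEq n₀ hM ha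
  exact ⟨P, hP, hPp, hmod.dvd⟩

/-! ## §2. The row `|b| = 2` -/

/-- **`|b| = 2` is killed** at every odd level. [cite: Pollack2003, Conj. 6.3] -/
theorem chi_eq_zero_of_natAbs_b_eq_two_odd [NeZero N] (hN : Odd N)
    (hadd : ∀ γ δ : Gamma0 N, χ (γ * δ) = χ γ + χ δ)
    (hsmall : ∀ γ : Gamma0 N, ((γ : SL(2, ℤ)) 0 0 + (γ : SL(2, ℤ)) 1 1).natAbs ≤ 2 → χ γ = 0)
    (hkill : ∀ γ : Gamma0 N, (∃ k : ℕ, 1 ≤ k ∧ ((γ : SL(2, ℤ)) 1 1).natAbs = 4 ^ k) → χ γ = 0)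
    (hB1 : ∀ β : Gamma0 N, (β : SL(2, ℤ)) 0 1 = -1 → χ β = 0)
    (γ : Gamma0 N) (hb : ((γ : SL(2, ℤ)) 0 1).natAbs = 2) : χ γ = 0 := by
  -- reduce to `b = −2`
  wlog hneg : (γ : SL(2, ℤ)) 0 1 = -2 generalizing γ
  · have hpos : (γ : SL(2, ℤ)) 0 1 = 2 := by
      rcases Int.natAbs_eq_iff.mp hb with h | h
      · exact_mod_cast h
      · exact absurd (by exact_mod_cast h) hneg
    rw [← Potential.chi_inv hadd γ]
    exact this γ⁻¹ (by rw [coe_inv_apply_zero_one, hpos]; rfl) (by rw [coe_inv_apply_zero_one, hpos])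
  set a : ℤ := (γ : SL(2, ℤ)) 0 0 with ha_def
  -- `a` is odd and prime to `N`
  have hcopa : IsCoprime a (2 * N) := by
    have h := isCoprime_apply_zero_zero_mul γ
    rw [hneg] at h
    rw [show (2 : ℤ) * N = -(-2 * (N : ℤ)) by ring]
    exact h.neg_right
  -- Dirichlet prime `P ≡ 7 (mod 8)`, `P ≡ a (mod N)`, via `a* = a + N²(7 − a)`
  set aS : ℤ := a + (N : ℤ) ^ 2 * (7 - a) with haS
  have hN8 : (8 : ℤ) ∣ (N : ℤ) ^ 2 - 1 := by
    have hNo : Odd (N : ℤ) := by exact_mod_cast hN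
    exact Int.eight_dvd_sq_sub_one_of_odd hNo
  have haS8 : (8 : ℤ) ∣ aS - 7 := by
    have : aS - 7 = ((N : ℤ) ^ 2 - 1) * (7 - a) := by rw [haS]; ring
    rw [this]; exact hN8.mul_right _
  have haSN : (N : ℤ) ∣ aS - a := ⟨(N : ℤ) * (7 - a), by rw [haS]; ring⟩
  have hcopS : IsCoprime aS (8 * N : ℕ) := by
    push_cast
    refine IsCoprime.mul_right ?_ ?_
    · -- `aS ≡ 7 (mod 8)`
      obtain ⟨w, hw⟩ := haS8
      have : aS = 7 + 8 * w := by linear_combination hw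
      rw [this]
      exact (Int.isCoprime_iff_gcd_eq_one.mpr (by norm_num) : IsCoprime (7 : ℤ) 8).add_mul_left_left w
    · obtain ⟨w, hw⟩ := haSN
      have : aS = a + N * w := by linear_combination hw
      rw [this]
      exact (hcopa.of_mul_right_right).add_mul_left_left w
  obtain ⟨P, hP7, hPp, hPdvd⟩ := exists_prime_sub_dvd (8 * N) (Nat.mul_ne_zero (by norm_num) (NeZero.ne N)) aS hcopS 7
  haveI := Fact.mk hPp
  have hP8 : (8 : ℤ) ∣ (P : ℤ) - 7 := by
    have h1 : (8 : ℤ) ∣ aS - P := (Int.dvd_mul_right 8 N).trans (by exact_mod_cast hPdvd)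
    have := Int.dvd_sub haS8 h1
    have e : aS - 7 - (aS - P) = (P : ℤ) - 7 := by ring
    rwa [e] at this
  have hPmod8 : P % 8 = 7 := by obtain ⟨w, hw⟩ := hP8; omega
  have hP2 : P ≠ 2 := by omega
  -- `2^{(P−1)/2} = 1` in `ZMod P` (Euler, `2` is a square mod `P ≡ 7 (8)`)
  have h2sq : IsSquare (2 : ZMod P) := (ZMod.exists_sq_eq_two_iff hP2).mpr (Or.inr hPmod8)
  have h2ne : (2 : ZMod P) ≠ 0 := by
    intro h
    have : ((2 : ℕ) : ZMod P) = 0 := by exact_mod_cast h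
    rw [ZMod.natCast_eq_zero_iff] at this
    have := Nat.le_of_dvd (by norm_num) this; omega
  have hE : (2 : ZMod P) ^ (P / 2) = 1 := (ZMod.euler_criterion P h2ne).mp h2sq
  set k : ℕ := (P - 3) / 4 with hk_def
  have hk1 : 1 ≤ k := by omega
  have hPk : (P : ℤ) ∣ (2 : ℤ) * 4 ^ k - 1 := by
    rw [← ZMod.intCast_zmod_eq_zero_iff_dvd]
    push_cast
    have e : (2 : ZMod P) * 4 ^ k = 2 ^ (P / 2) := by
      rw [show (4 : ZMod P) = 2 ^ 2 by norm_num, ← pow_mul, ← pow_succ', show 2 * k + 1 = P / 2 by omega]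
    rw [e, hE, sub_self]
  -- `2N ∣ a − P`
  have haodd : ¬ (2 : ℤ) ∣ a := by
    intro h2
    obtain ⟨u, v, huv⟩ := hcopa.of_mul_right_left
    obtain ⟨c, hc⟩ := h2
    rw [hc] at huv
    have h21 : (1 : ℤ) = 2 * (u * c + v) := by linear_combination -huv
    omega
  have hPa : ((2 * N : ℕ) : ℤ) ∣ a - P := by
    have hNd : (N : ℤ) ∣ a - P := by
      have h1 : (N : ℤ) ∣ aS - P := (Int.dvd_mul_left 8 N).trans (by exact_mod_cast hPdvd)
      have := Int.dvd_sub h1 haSN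
      have e : aS - ↑P - (aS - a) = a - P := by ring
      rwa [e] at this
    have h2d : (2 : ℤ) ∣ a - P := by
      have hPodd : ¬ 2 ∣ P := by omega
      omega
    have h2N : IsCoprime (2 : ℤ) N := by
      have hNo : Odd (N : ℤ) := by exact_mod_cast hN
      obtain ⟨w, hw⟩ := hNo
      exact ⟨-w, 1, by rw [hw]; ring⟩
    push_cast
    exact h2N.mul_dvd h2d hNd
  exact chi_eq_zero_of_b_neg_of_prime_dvd hN hadd hsmall hkill hB1 2 (by rw [hneg]; rfl) P hPa k hk1
    (by exact_mod_cast hPk)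

/-! ## §3. The rows `|b| = 4^i` -/

/-- **`|b| = 4^i` is killed** at every odd level (`i ≥ 0`). [cite: Pollack2003, Conj. 6.3] -/
theorem chi_eq_zero_of_natAbs_b_eq_four_pow_odd [NeZero N] (hN : Odd N)
    (hadd : ∀ γ δ : Gamma0 N, χ (γ * δ) = χ γ + χ δ)
    (hsmall : ∀ γ : Gamma0 N, ((γ : SL(2, ℤ)) 0 0 + (γ : SL(2, ℤ)) 1 1).natAbs ≤ 2 → χ γ = 0)
    (hkill : ∀ γ : Gamma0 N, (∃ k : ℕ, 1 ≤ k ∧ ((γ : SL(2, ℤ)) 1 1).natAbs = 4 ^ k) → χ γ = 0)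
    (hB1 : ∀ β : Gamma0 N, (β : SL(2, ℤ)) 0 1 = -1 → χ β = 0)
    (i : ℕ) (γ : Gamma0 N) (hb : ((γ : SL(2, ℤ)) 0 1).natAbs = 4 ^ i) : χ γ = 0 := by
  -- reduce to `b = −4^i`
  wlog hneg : (γ : SL(2, ℤ)) 0 1 = -(4 ^ i : ℕ) generalizing γ
  · have hpos : (γ : SL(2, ℤ)) 0 1 = (4 ^ i : ℕ) := by
      rcases Int.natAbs_eq_iff.mp hb with h | h
      · exact h
      · exact absurd h hneg
    rw [← Potential.chi_inv hadd γ]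
    exact this γ⁻¹ (by rw [coe_inv_apply_zero_one, hpos, Int.natAbs_neg]; simp) (by rw [coe_inv_apply_zero_one, hpos])
  rcases Nat.eq_zero_or_pos i with hi | hi
  · subst hi; exact hB1 γ (by rw [hneg]; simp)
  set a : ℤ := (γ : SL(2, ℤ)) 0 0 with ha_def
  have hcopa : IsCoprime a ((4 ^ i * N : ℕ) : ℤ) := by
    have h := isCoprime_apply_zero_zero_mul γ
    rw [hneg] at h
    push_cast at h ⊢
    rw [show (4 : ℤ) ^ i * N = -(-(4 ^ i) * (N : ℤ)) by ring]
    exact h.neg_right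
  obtain ⟨P, hP2, hPp, hPdvd⟩ := exists_prime_sub_dvd (4 ^ i * N) (Nat.mul_ne_zero (pow_ne_zero _ (by norm_num)) (NeZero.ne N)) a hcopa 2
  haveI := Fact.mk hPp
  have h4 : (4 : ZMod P) ≠ 0 := by
    intro h
    have : ((4 : ℕ) : ZMod P) = 0 := by exact_mod_cast h
    rw [ZMod.natCast_eq_zero_iff] at this
    have h' : P ∣ 2 ^ 2 := by norm_num at this ⊢; exact this
    have := (Nat.prime_dvd_prime_iff_eq hPp Nat.prime_two).mp (hPp.dvd_of_dvd_pow h')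
    omega
  set k : ℕ := (P - 1) * (i + 1) - i with hk_def
  have hP3 : 3 ≤ P := by omega
  have hk1 : 1 ≤ k := by
    have : i + 1 ≤ (P - 1) * (i + 1) := Nat.le_mul_of_pos_left _ (by omega)
    omega
  have hik : i + k = (P - 1) * (i + 1) := by
    have : i + 1 ≤ (P - 1) * (i + 1) := Nat.le_mul_of_pos_left _ (by omega)
    omega
  have hPk : (P : ℤ) ∣ ((4 ^ i : ℕ) : ℤ) * 4 ^ k - 1 := by
    rw [← ZMod.intCast_zmod_eq_zero_iff_dvd]
    push_cast
    rw [← pow_add, hik, pow_mul, ZMod.pow_card_sub_one_eq_one h4, one_pow, sub_self]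
  exact chi_eq_zero_of_b_neg_of_prime_dvd hN hadd hsmall hkill hB1 (4 ^ i) hneg P hPdvd k hk1 hPk

end Summit.BirchSwinnertonDyer.BirchSwinnertonDyer.Theorems.SignedMuAtTwo
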